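import Summits.QuantumFields.YangMills.Theorems.UnitScaleTiltHistoryTailIntEnvelope
import Literature.MathematicalPhysics.QuantumFieldTheory.Balaban1983to89.T4StabilityFloor
import Literature.MathematicalPhysics.QuantumFieldTheory.Balaban1983to89.T4StabilityFloorUnitary
import Literature.MathematicalPhysics.QuantumFieldTheory.Balaban1983to89.HaarSmallBallClosedSubgroup
import Literature.MathematicalPhysics.QuantumFieldTheory.Balaban1983to89.B10Eq5RegularAction
import Literature.MathematicalPhysics.QuantumFieldTheory.Balaban1983to89.T3CruxEstimates
import Summits.QuantumFields.YangMills.Theorems.UnitScaleTiltHistoryTailChessboardT3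
import Summits.QuantumFields.YangMills.Theorems.UnitScaleTiltHistoryTailLowMassCore
import HarnessLib

/-!
# Route `UnitScaleTilt` — crux `HistoryTailL` (stmt-QuantumFields-19936), R-57χ successor line: STUB 4b CORE AT THE INTERIOR DATUM OF A FAMILY OF DATA CORES —
# the trivial-history minimiser's action on a small ball and the pointwise lower bound of the (47)-minorant `low_j = 𝟙[interior_j]·e^{−mainT(triv)+Pint(triv)}` on the
# bond ball of radius `min(1,b₀)·g_j/(8·max(B₃,1))` (`HistoryTailLowMassV3` CORE, ym3-torus-p2 g11 / ★18916-p1 g4, re-run with `h.dataT3v3 hc γ hγ hγ1 π ↦ dataIntV3 qf π`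
# and the ball radius divided by `max(B₃,1)` so that the ball sits in the INTERIOR window `θBal(K−j)/max(B₃,1)`; negation-lens pre-check N-g24-2) — seat ym3-torus-p2 (g16)

WHAT.  For the interior datum `D = AlphaInputsT3AC.dataIntV3 qf π` of a family of data cores `qf : ∀ K, PkgCoreV3 F 𝔠 γ hγ hγ1 K`: §2 `β_K·A(U_j(triv,W)) ≤ (2B₃²+2)·N_j³` for
`ε₁`-small `W`, `ε₁² ≤ g_j²`, `ε₁ ≤ (qf K).a₁` (row r1 = [Balaban1985Variational] Thm 1 (8) at the FREE radius `ε₁`, core field `minRows`; `B₃ε₁ ≤ (qf K).a₀` from the core's own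
`consts_ok`); at `j = 0` the minimiser is the datum (`hU0`) and `Pint_0 = 0`; §3 `low_j(W) ≥ exp(−(2B₃²+2+CP)N_j³)` on the bond ball of radius `min(1,b₀)g_j/(8·max(B₃,1))`:
`4·radius < θBal(K−j)/max(B₃,1)` puts the ball in the interior window (`χ = 1`, `dataIntV3_chi_eq_one_of_plaqSmall`), a fortiori in the route's window (the pair `(triv, W)` is
charged, `dataIntV3_admOnSmall`, so `|Pint| ≤ CP·N³` by `PintSize`) and in `PlaqSmall (min(1,b₀)g_j)` (the main-term bound).  No new row, no new minimiser fact.  Nothing of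
[Balaban1985UV3] is asserted; CONDITIONAL only on the family `qf`.
-/

noncomputable section

namespace Summit.QuantumFields.YangMills.Theorems.HistoryTailLowMassInt

open MeasureTheory
open scoped Matrix.Norms.L2Operator
open Literature.MathematicalPhysics.QuantumFieldTheory (haarProbability)
open Literature.MathematicalPhysics.QuantumFieldTheory.Balaban1983to89
open Literature.MathematicalPhysics.QuantumFieldTheory.Balaban1983to89.T3ContinuumYM3Torus
open Literature.MathematicalPhysics.QuantumFieldTheory.Balaban1983to89.T3UnitLawDensityEML (ℰp)
open Literature.MathematicalPhysics.QuantumFieldTheory.Balaban1983to89.T3UnitScaleTilt (θBal)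
open Literature.MathematicalPhysics.QuantumFieldTheory.Balaban1983to89.T3LevelShift (fieldShift fieldShift_symm_fieldShift)
open Literature.MathematicalPhysics.QuantumFieldTheory.Balaban1983to89.T3PrintedRegularMinimiser (regFibrePr mem_regFibrePr_iff)
open Literature.MathematicalPhysics.QuantumFieldTheory.Balaban1983to89.T3RegularMinimiser (regThreshold)
open Literature.MathematicalPhysics.QuantumFieldTheory.Balaban1983to89.T3AlphaInputsAC
open Literature.MathematicalPhysics.QuantumFieldTheory.Balaban1983to89.T4StabilityFloor (bondBall mem_bondBall
  fieldMeasure_real_bondBall measurableSet_bondBall card_pbond card_plaq)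
open Summit.QuantumFields.Balaban3D.Carriers (suGroupModel Hist)
open Summit.QuantumFields.Balaban3D.Proofs.Primitives (AlphaConsts)
open Summit.QuantumFields.YangMills.Theorems.HistoryTailLowMass
  (haar_real_ball_ge card_plaq_T3 card_pbond_T3 sitesPerDir_zero_eq_mul wilsonAction4_le_of_plaqSmall mul_coupling_le_θBal scheme_β_eq_pow_div)

/-! ## §1 Geometry and Haar volume: the `SU(2)` small ball, the bond ball, the plaquette and bond counts of the family -/

/-! ## §2 The main term on a small ball: the trivial-history minimiser is `B₃ε₁·L^{−2(K−n)}`-regular for `ε₁`-small data -/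

section Datum

variable {F : T3Family} {𝔠 : AlphaConsts F.L (suGroupModel 2).N} {γ : ℝ} {hγ : 0 < γ} {hγ1 : γ ≤ (min 𝔠.gamma0 1) ^ 2}
  (qf : ∀ K, AlphaInputsT3AC.PkgCoreV3 F 𝔠 γ hγ hγ1 K) (π : AlphaInputsT3AC.PolymerT3 F)

/-- **THE MAIN TERM BELOW THE TOP, ON `ε₁`-SMALL DATA**: for `n < K` (at least one averaging step), `0 < ε₁ ≤ a₁` with `ε₁² ≤ g² = γL^{−n}`,
and every `ε₁`-small level-`(K − n)` field `W`, the Wilson action of the trivial-history minimiser in route units is at most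
`2B₃²·N_{K−n}³`: the minimiser row r1 (core field `minRows`.1 = [Balaban1985Variational] Thm 1 (8) at the FREE radius `ε₁`)
puts it in print's space `𝔘_k(B₃ε₁)`, i.e. every fine plaquette within `B₃ε₁L^{−2(K−n)}` of `1`; then (11) and the plaquette count.
[cite: Balaban1985Variational, Thm 1 (8) p.279; Balaban1985UV3, (11) p.258] -/
theorem mainT_le_of_small_pos (K n : ℕ) (hnK : n < K) {ε₁ : ℝ} (hε₁ : 0 < ε₁) (ha₁ : ε₁ ≤ (qf K).a₁)
    (hεg : ε₁ ^ 2 ≤ γ * ((F.L : ℝ)⁻¹) ^ n)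
    (W : GaugeField (F.P K) (K - n) (Matrix.specialUnitaryGroup (Fin 2) ℂ)) (hW : PlaqSmall ε₁ W) :
    (F.scheme ℰp γ).β K *
        wilsonAction4 ((AlphaInputsT3AC.dataIntV3 qf π).Umin K (K - n) ((AlphaInputsT3AC.dataIntV3 qf π).triv K (K - n)) W) ≤
      (2 * 𝔠.B₃ ^ 2 + 2) * ((F.P K).sitesPerDir (K - n) : ℝ) ^ 3 := by
  set p := qf K with hp
  have hs : (F.PP F.m K).sitesPerDir (K - n) = (F.PP F.m n).sitesPerDir 0 :=
    F.sitesPerDir_eq (m := F.m) (K := K) (j := K - n) (m' := F.m) (K' := n) (j' := 0) (by omega)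
  set V : GaugeField (F.P n) 0 (Matrix.specialUnitaryGroup (Fin 2) ℂ) := fieldShift hs.symm W with hV
  have hWV : fieldShift hs V = W := fieldShift_symm_fieldShift hs W
  have hVsmall : PlaqSmall ε₁ V := (T3CruxEstimates.plaqSmall_fieldShift F hs.symm ε₁ W).mpr hW
  have ha₁' : ε₁ ≤ p.a₁ := ha₁
  have hB₃ : 0 < 𝔠.B₃ := 𝔠.B₃_pos
  have hhi : 𝔠.B₃ * ε₁ ≤ p.a₀ := (mul_le_mul_of_nonneg_left ha₁' hB₃.le).trans p.consts_ok.2.2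
  have hmem := T3PrintedMinimiserExistence.regFibrePr_mono F (le_refl (𝔠.B₃ * ε₁)) V
    (p.minRows.1 n hnK ε₁ (𝔠.B₃ * ε₁) hε₁ ha₁' le_rfl hhi V hVsmall).1
  rw [hWV] at hmem
  have hps := ((mem_regFibrePr_iff (F := F)).mp hmem).2.plaqSmall
  -- the fine plaquettes of the minimiser are `B₃ε₁L^{−2(K−n)}`-small
  have hU : PlaqSmall (𝔠.B₃ * ε₁ * ((F.L : ℝ)⁻¹) ^ (2 * (K - n)))
      ((AlphaInputsT3AC.dataIntV3 qf π).Umin K (K - n) ((AlphaInputsT3AC.dataIntV3 qf π).triv K (K - n)) W) := hps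
  have hA := wilsonAction4_le_of_plaqSmall hU
  rw [card_plaq_T3, sitesPerDir_zero_eq_mul F hnK.le] at hA
  -- arithmetic
  have hL : (1 : ℝ) < F.L := by exact_mod_cast F.hL.2
  have hL0 : (0 : ℝ) < F.L := by linarith
  set ℓ : ℝ := (F.L : ℝ) with hℓ
  set a : ℝ := ℓ ^ (K - n) with ha
  set N : ℝ := ((F.P K).sitesPerDir (K - n) : ℝ) with hN
  have ha0 : 0 < a := pow_pos hL0 _
  have hN0 : 0 ≤ N := by positivity
  have hβ : (F.scheme ℰp γ).β K = ℓ ^ n * a / γ := by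
    rw [scheme_β_eq_pow_div, ha, ← pow_add]
    congr 2
    omega
  have hβ0 : 0 ≤ (F.scheme ℰp γ).β K := by rw [hβ]; positivity
  have hρ : (ℓ⁻¹) ^ (2 * (K - n)) = (a ^ 2)⁻¹ := by
    rw [ha, ← pow_mul, mul_comm, inv_pow]
  rw [hρ] at hA
  have hA' : wilsonAction4 ((AlphaInputsT3AC.dataIntV3 qf π).Umin K (K - n) ((AlphaInputsT3AC.dataIntV3 qf π).triv K (K - n)) W) ≤
      3 / 2 * 𝔠.B₃ ^ 2 * N ^ 3 * (ε₁ ^ 2 * a⁻¹) := by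
    refine hA.trans (le_of_eq ?_)
    field_simp
  have hg : ε₁ ^ 2 * ℓ ^ n / γ ≤ 1 := by
    have hℓn : 0 < ℓ ^ n := pow_pos hL0 n
    rw [div_le_one hγ]
    have : ε₁ ^ 2 ≤ γ * (ℓ ^ n)⁻¹ := by rw [← inv_pow]; exact hεg
    calc ε₁ ^ 2 * ℓ ^ n ≤ γ * (ℓ ^ n)⁻¹ * ℓ ^ n := mul_le_mul_of_nonneg_right this hℓn.le
      _ = γ := by field_simp
  calc (F.scheme ℰp γ).β K *
        wilsonAction4 ((AlphaInputsT3AC.dataIntV3 qf π).Umin K (K - n) ((AlphaInputsT3AC.dataIntV3 qf π).triv K (K - n)) W)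
      ≤ (ℓ ^ n * a / γ) * (3 / 2 * 𝔠.B₃ ^ 2 * N ^ 3 * (ε₁ ^ 2 * a⁻¹)) := by
        rw [← hβ]; exact mul_le_mul_of_nonneg_left hA' hβ0
    _ = 3 / 2 * 𝔠.B₃ ^ 2 * N ^ 3 * (ε₁ ^ 2 * ℓ ^ n / γ) := by field_simp
    _ ≤ 3 / 2 * 𝔠.B₃ ^ 2 * N ^ 3 * 1 := mul_le_mul_of_nonneg_left hg (by positivity)
    _ ≤ (2 * 𝔠.B₃ ^ 2 + 2) * N ^ 3 := by nlinarith [sq_nonneg 𝔠.B₃, pow_nonneg hN0 3]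

/-- **THE MAIN TERM AT THE FINEST LEVEL `j = 0`** (no averaging: `U_0(triv, W) = W`, core field `hU0`): for `ε₁² ≤ g_0² = γL^{−K}` and an
`ε₁`-small `W`, `β_K·A(W) ≤ (3/2)·N_0³ ≤ (2B₃² + 2)·N_0³`. [cite: Balaban1985UV3, (11) p.258 and (42) p.266] -/
theorem mainT_le_of_small_zero (K : ℕ) {ε₁ : ℝ} (hεg : ε₁ ^ 2 ≤ γ * ((F.L : ℝ)⁻¹) ^ (K - 0))
    (W : GaugeField (F.P K) 0 (Matrix.specialUnitaryGroup (Fin 2) ℂ)) (hW : PlaqSmall ε₁ W) :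
    (F.scheme ℰp γ).β K *
        wilsonAction4 ((AlphaInputsT3AC.dataIntV3 qf π).Umin K 0 ((AlphaInputsT3AC.dataIntV3 qf π).triv K 0) W) ≤
      (2 * 𝔠.B₃ ^ 2 + 2) * ((F.P K).sitesPerDir 0 : ℝ) ^ 3 := by
  have hU : (AlphaInputsT3AC.dataIntV3 qf π).Umin K 0 ((AlphaInputsT3AC.dataIntV3 qf π).triv K 0) W = W :=
    (qf K).hU0 W
  rw [hU]
  have hA := wilsonAction4_le_of_plaqSmall hW
  rw [card_plaq_T3] at hA
  have hL : (1 : ℝ) < F.L := by exact_mod_cast F.hL.2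
  have hL0 : (0 : ℝ) < F.L := by linarith
  set ℓ : ℝ := (F.L : ℝ) with hℓ
  set N : ℝ := ((F.P K).sitesPerDir 0 : ℝ) with hN
  have hN0 : 0 ≤ N := by positivity
  rw [Nat.sub_zero] at hεg
  have hβ : (F.scheme ℰp γ).β K = ℓ ^ K / γ := scheme_β_eq_pow_div γ K
  have hβ0 : 0 ≤ (F.scheme ℰp γ).β K := by rw [hβ]; positivity
  have hg : ε₁ ^ 2 * ℓ ^ K / γ ≤ 1 := by
    have hℓn : 0 < ℓ ^ K := pow_pos hL0 K
    rw [div_le_one hγ]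
    have : ε₁ ^ 2 ≤ γ * (ℓ ^ K)⁻¹ := by rw [← inv_pow]; exact hεg
    calc ε₁ ^ 2 * ℓ ^ K ≤ γ * (ℓ ^ K)⁻¹ * ℓ ^ K := mul_le_mul_of_nonneg_right this hℓn.le
      _ = γ := by field_simp
  calc (F.scheme ℰp γ).β K * wilsonAction4 W
      ≤ (ℓ ^ K / γ) * (3 * N ^ 3 * (ε₁ ^ 2 / 2)) := by rw [← hβ]; exact mul_le_mul_of_nonneg_left hA hβ0
    _ = 3 / 2 * N ^ 3 * (ε₁ ^ 2 * ℓ ^ K / γ) := by ring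
    _ ≤ 3 / 2 * N ^ 3 * 1 := mul_le_mul_of_nonneg_left hg (by positivity)
    _ ≤ (2 * 𝔠.B₃ ^ 2 + 2) * N ^ 3 := by nlinarith [sq_nonneg 𝔠.B₃, pow_nonneg hN0 3]

/-- **NO INTERACTION AT `j = 0`**: `Pint_0(triv, W) = 0` for the interior datum (the series' `Pint 0 = 0`, `noInteraction0_towerOfAC`).
[cite: Balaban1985UV3, (1) p.256 and (43) p.266] -/
theorem pint_zero (K : ℕ) (W : GaugeField (F.P K) 0 (Matrix.specialUnitaryGroup (Fin 2) ℂ)) :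
    (AlphaInputsT3AC.dataIntV3 qf π).Pint K 0 ((AlphaInputsT3AC.dataIntV3 qf π).triv K 0) W = 0 :=
  Summit.QuantumFields.Balaban3D.Proofs.InputsAC.noInteraction0_towerOfAC 𝔠.lane (qf K).X
    (qf K).𝔖 (Hist.triv (F.P K) 0) W

end Datum


/-! ## §3 The (47)-minorant on the bond ball -/

section Assembly

variable {F : T3Family} {𝔠 : AlphaConsts F.L (suGroupModel 2).N} {γ : ℝ} {hγ : 0 < γ} {hγ1 : γ ≤ (min 𝔠.gamma0 1) ^ 2}
  (qf : ∀ K, AlphaInputsT3AC.PkgCoreV3 F 𝔠 γ hγ hγ1 K) (π : AlphaInputsT3AC.PolymerT3 F)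

/-- **THE (47)-MINORANT ON THE BOND BALL OF RADIUS `min(1,b₀)·g_j/(8·max(B₃,1))`**: the ball lies inside the INTERIOR window `θBal(K−j)/max(B₃,1)` (`θBal ≥ b₀g_j`), so
`χ_j = 1` (`dataIntV3_chi_eq_one_of_plaqSmall`), inside the route's window, so the pair `(triv, W)` is charged (`dataIntV3_admOnSmall`) and `|Pint| ≤ CP·θBal(K−j+1)²N³ ≤ CP·N³`
(`PintSize`; `Pint_0 = 0` at `j = 0`); with the main-term bound `β_K·A(U_j(triv,W)) ≤ (2B₃²+2)N³` this gives
`low_j(W) ≥ exp(−(2B₃² + 2 + CP)·N_j³)`. [cite: Balaban1985UV3, (47) p.267 and (44)-(46) p.267] -/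
theorem low_ge_on_ball {CP : ℝ} (hCP : 0 ≤ CP) (hPS : PintSize (AlphaInputsT3AC.dataIntV3 qf π) 𝔠.b₀ 𝔠.p₀ CP)
    (hθ1 : ∀ i, θBal F.L γ 𝔠.b₀ 𝔠.p₀ i ≤ 1) (hγ1' : γ ≤ 1) (K k : ℕ) (hk : k ≤ K)
    (hmain : ∀ W : GaugeField (F.P K) k (Matrix.specialUnitaryGroup (Fin 2) ℂ),
      PlaqSmall (min 1 𝔠.b₀ * Real.sqrt (γ * ((F.L : ℝ)⁻¹) ^ (K - k))) W →
        (F.scheme ℰp γ).β K *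
            wilsonAction4 ((AlphaInputsT3AC.dataIntV3 qf π).Umin K k ((AlphaInputsT3AC.dataIntV3 qf π).triv K k) W) ≤
          (2 * 𝔠.B₃ ^ 2 + 2) * ((F.P K).sitesPerDir k : ℝ) ^ 3)
    (W : GaugeField (F.P K) k (Matrix.specialUnitaryGroup (Fin 2) ℂ))
    (hWb : ∀ b, dist1 (W b) ≤ min 1 𝔠.b₀ * Real.sqrt (γ * ((F.L : ℝ)⁻¹) ^ (K - k)) / (8 * max 𝔠.B₃ 1)) :
    Real.exp (-((2 * 𝔠.B₃ ^ 2 + 2 + CP) * ((F.P K).sitesPerDir k : ℝ) ^ 3)) ≤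
      (AlphaInputsT3AC.dataIntV3 qf π).low K k W := by
  set g : ℝ := Real.sqrt (γ * ((F.L : ℝ)⁻¹) ^ (K - k)) with hg
  set t : ℝ := min 1 𝔠.b₀ with ht
  set N : ℝ := ((F.P K).sitesPerDir k : ℝ) with hN
  have hL1 : 1 ≤ F.L := F.hL.2.le
  have hg0 : 0 < g := (T3ThresholdSmallness.sqrt_coupling_pos_le hL1 hγ (K - k)).1
  have hg1 : g ≤ 1 := T3Thresholds.coupling_le_one hL1 hγ hγ1' (K - k)
  have ht0 : 0 < t := lt_min one_pos 𝔠.b₀_pos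
  have htb : t ≤ 𝔠.b₀ := min_le_right _ _
  have hε0 : 0 < t * g := mul_pos ht0 hg0
  have hN0 : 0 ≤ N := by positivity
  -- the INTERIOR window contains the ball (`4·radius < θBal/max(B₃,1)`), hence so do the route's window and `PlaqSmall (t·g)`
  set Mx : ℝ := max 𝔠.B₃ 1 with hMx
  have hMx1 : 1 ≤ Mx := le_max_right _ _
  have hMx0 : 0 < Mx := lt_of_lt_of_le one_pos hMx1
  have hθ : t * g ≤ θBal F.L γ 𝔠.b₀ 𝔠.p₀ (K - k) :=
    (mul_le_mul_of_nonneg_right htb hg0.le).trans (mul_coupling_le_θBal 𝔠.b₀_pos.le 𝔠.p₀_pos.le (K - k) hg0 hg1)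
  have hδle : t * g / (8 * Mx) ≤ t * g / 8 :=
    div_le_div_of_nonneg_left hε0.le (by norm_num) (by nlinarith)
  have hWb' : ∀ b, dist1 (W b) ≤ t * g / 8 := fun b => (hWb b).trans hδle
  have hWε : PlaqSmall (t * g) W := T4StabilityFloorUnitary.plaqSmall_of_bond_le hWb' (by linarith)
  have hWθ : PlaqSmall (θBal F.L γ 𝔠.b₀ 𝔠.p₀ (K - k)) W := T4StabilityFloorUnitary.plaqSmall_of_bond_le hWb' (by linarith)
  have h4δ : 4 * (t * g / (8 * Mx)) < θBal F.L γ 𝔠.b₀ 𝔠.p₀ (K - k) / Mx := by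
    rw [show 4 * (t * g / (8 * Mx)) = (t * g / 2) / Mx by field_simp; ring]
    exact div_lt_div_of_pos_right (by linarith) hMx0
  have hWint : PlaqSmall (θBal F.L γ 𝔠.b₀ 𝔠.p₀ (K - k) / max 𝔠.B₃ 1) W := T4StabilityFloorUnitary.plaqSmall_of_bond_le hWb h4δ
  -- `χ = 1` on the interior window
  have hχ : (AlphaInputsT3AC.dataIntV3 qf π).χ K k W = 1 := AlphaInputsT3AC.dataIntV3_chi_eq_one_of_plaqSmall qf π K k W hWint
  -- the main term
  have hmainT : (AlphaInputsT3AC.dataIntV3 qf π).mainT K k ((AlphaInputsT3AC.dataIntV3 qf π).triv K k) W ≤ (2 * 𝔠.B₃ ^ 2 + 2) * N ^ 3 := by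
    rw [AlphaInputsT3AC.dataIntV3_mainTermIsAction qf π K k ((AlphaInputsT3AC.dataIntV3 qf π).triv K k) W]
    exact hmain W hWε
  -- the interaction
  have hPint : -(CP * N ^ 3) ≤ (AlphaInputsT3AC.dataIntV3 qf π).Pint K k ((AlphaInputsT3AC.dataIntV3 qf π).triv K k) W := by
    rcases Nat.eq_zero_or_pos k with hk0 | hkpos
    · subst hk0
      rw [pint_zero qf π K W]
      have : 0 ≤ CP * N ^ 3 := by positivity
      linarith
    · have hadm := AlphaInputsT3AC.dataIntV3_admOnSmall qf π K k W hk hWθ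
      have hsize := hPS K k ((AlphaInputsT3AC.dataIntV3 qf π).triv K k) W hk hkpos hadm
      have hθ0 : 0 ≤ θBal F.L γ 𝔠.b₀ 𝔠.p₀ (K - k + 1) :=
        (T3MinimiserStabilityReduction.θBal_pos hL1 hγ hγ1' 𝔠.b₀_pos 𝔠.p₀ (K - k + 1)).le
      have hθsq : θBal F.L γ 𝔠.b₀ 𝔠.p₀ (K - k + 1) ^ 2 ≤ 1 := pow_le_one₀ hθ0 (hθ1 _)
      have hb : CP * θBal F.L γ 𝔠.b₀ 𝔠.p₀ (K - k + 1) ^ 2 * N ^ 3 ≤ CP * N ^ 3 := by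
        have h1 : CP * θBal F.L γ 𝔠.b₀ 𝔠.p₀ (K - k + 1) ^ 2 ≤ CP * 1 := mul_le_mul_of_nonneg_left hθsq hCP
        have := mul_le_mul_of_nonneg_right h1 (pow_nonneg hN0 3)
        linarith
      have hlow := (abs_le.mp hsize).1
      linarith
  -- assemble
  show _ ≤ AlphaDataT3.low (AlphaInputsT3AC.dataIntV3 qf π) K k W
  unfold AlphaDataT3.low
  rw [hχ, one_mul]
  exact Real.exp_le_exp.mpr (by linarith)

end Assembly

end Summit.QuantumFields.YangMills.Theorems.HistoryTailLowMassInt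

end
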